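import Mathlib
import Literature.Barriers.ValiantsHypothesis.AlgebraicNaturalProofs
import Literature.Computability.AlgebraicComplexity.ArithCircuitProofs
import Summits.ValiantsHypothesis.ValiantsHypothesis.Theorems.BarrierLeverPartitionMinorsHitByVPAdditiveDoor

/-!
# Route BarrierLever — item `PartitionMinorsHitByVP` (stmt-ValiantsHypothesis-19717):
# OR-PROJECTION LAYOUTS ARE HIT — the first unconditional class through the additive door

Helper file (`--supports stmt-ValiantsHypothesis-19717`; cell valiant-natproofs, rung V4, 𝒟-side,
prover seat val-np-p6 gen 3). Definition-free. Closes NO item.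

A layout `(u, w)` is an OR-PROJECTION layout if the column sets are obtained from the row sets by
relabelling every row coordinate `a` as a SET `N a` of column coordinates and taking unions:
`w i = ⋃_{a ∈ u i} N a` for one labelling `N : Fin h → Finset (Fin h)` (the labels may overlap
arbitrarily; `w` injective). Examples: identical and permuted layouts (`N a = {π a}`), deletions and
identifications of coordinates, blow-ups `a ↦ N a`, STARS (`u` = `∅` and singletons, `w` = `∅` and ANY
distinct nonempty sets — the shape that killed the universal witness TNS), and the super-polynomial
"chunk" families of the seat memo (rows of weight `≤ ⌈k/s⌉` spread over `C(k,≤s)` coordinates,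
columns ALL subsets of a `k`-block), on which every sum of `p` product states with
`p · C(k, ≤⌈k/s⌉) < 2^k` is singular (sibling file `…ProductStateRankBound`).

* `det_ne_zero_of_dominance` — a matrix whose nonzero entries `M i j ≠ 0` force `w j ⊆ w i`
  (`w` injective) and whose diagonal is nonzero is nonsingular (block-triangular by cardinality,
  diagonal blocks diagonal).
* **`partitionMinor_hit_of_orProjection`** — OR-projection layouts are hit in `SmallCircuits ℂ (h+h) 5`
  (`h ≥ 2`): the additive door `…AdditiveDoor.partitionMinor_hit_of_additive_mem` at the 0/1 table
  `ω a c = [c ∈ N a]`, `ω₀ = 0`, whose matrix entry `∏_{c ∈ w j} #{a ∈ u i : c ∈ N a}` is nonzero iff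
  `w j ⊆ w i`.
* `partitionMinor_hit_symm` — the `x ↔ y` symmetry of item 19717's matrix (rename along the swap of
  the two halves of `Fin (h+h)`; degree and size do not increase), whence
  **`partitionMinor_hit_of_orProjection_rows`** — the mirror class `u i = ⋃_{c ∈ w i} N c`.

WHAT THIS IS NOT: OR-projections are a thin slice of the layouts the additive door reaches for a
GENERIC table (seat census: every layout at `h = 3`, all sampled layouts at `h = 4`, and every tested
low-weight-rows/block-columns family is hit by the additive witness or its mirror); nothing on crux
14610 or VP vs VNP.
-/

set_option linter.dupNamespace false

namespace Summit.ValiantsHypothesis.ValiantsHypothesis.Theorems.BarrierLever.AdditiveDoor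

open Finset MvPolynomial
open Literature.Barriers.ValiantsHypothesis Literature.Computability.AlgebraicComplexity

noncomputable section

variable {h : ℕ}

/-! ## 1. A dominance pattern forces a nonzero determinant -/

/-- A square matrix over `ℂ` indexed by `ι` such that `M i j ≠ 0 ⇒ w j ⊆ w i` for an injective family
of finite sets `w`, with nonzero diagonal, is nonsingular. -/
theorem det_ne_zero_of_dominance {ι α : Type*} [Fintype ι] [DecidableEq ι] [DecidableEq α]
    (M : Matrix ι ι ℂ) (w : ι → Finset α) (hw : Function.Injective w)
    (hdom : ∀ i j, M i j ≠ 0 → w j ⊆ w i) (hdiag : ∀ i, M i i ≠ 0) (n : ℕ)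
    (hn : ∀ i, (w i).card ≤ n) : M.det ≠ 0 := by
  set lv : ι → ℕ := fun i => n - (w i).card with hlv
  have hBT : M.BlockTriangular lv := by
    intro i j hij
    by_contra hne
    have hsub := Finset.card_le_card (hdom i j hne)
    have := hn i; have := hn j
    simp only [hlv] at hij
    omega
  rw [hBT.det]
  refine Finset.prod_ne_zero_iff.mpr fun t _ => ?_
  have hD : M.toSquareBlock lv t = Matrix.diagonal (fun i : {i // lv i = t} => M i.1 i.1) := by
    ext i j
    rw [Matrix.toSquareBlock_def, Matrix.of_apply, Matrix.diagonal_apply]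
    by_cases hij : i = j
    · subst hij; rw [if_pos rfl]
    · rw [if_neg hij]
      by_contra hne
      have hsub := hdom _ _ hne
      have hcard : (w i.1).card = (w j.1).card := by
        have hi := i.2; have hj := j.2; have := hn i.1; have := hn j.1
        simp only [hlv] at hi hj
        omega
      have heq : w j.1 = w i.1 := Finset.eq_of_subset_of_card_le hsub hcard.le
      exact hij (Subtype.ext (hw heq).symm)
  rw [hD, Matrix.det_diagonal]
  exact Finset.prod_ne_zero_iff.mpr fun i _ => hdiag i.1

/-! ## 2. OR-projection layouts -/

/-- **OR-projection layouts are hit.** If `w i = ⋃_{a ∈ u i} N a` for a labelling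
`N : Fin h → Finset (Fin h)` of the row coordinates by sets of column coordinates (`w` injective,
`h ≥ 2`), the layout matrix of `(u, w)` is nonsingular at some `f ∈ SmallCircuits ℂ (h+h) 5`. -/
theorem partitionMinor_hit_of_orProjection {ι : Type*} [Fintype ι] [DecidableEq ι] (h : ℕ)
    (hh : 2 ≤ h) (u w : ι → Finset (Fin h)) (hw : Function.Injective w)
    (N : Fin h → Finset (Fin h)) (hN : ∀ i, w i = (u i).biUnion N) :
    ∃ f ∈ SmallCircuits ℂ (h + h) 5,
      (Matrix.of fun i j : ι => MvPolynomial.coeff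
        (∑ a ∈ u i, Finsupp.single (Fin.castAdd h a) 1 +
          ∑ c ∈ w j, Finsupp.single (Fin.natAdd h c) 1) f).det ≠ 0 := by
  refine partitionMinor_hit_of_additive_mem h hh u w (fun _ => 0)
    (fun a c => if c ∈ N a then 1 else 0) ?_
  -- the matrix entry: `∏_{c ∈ w j} #{a ∈ u i : c ∈ N a}`
  have hentry : ∀ i j, (Matrix.of fun i j : ι => ∏ c ∈ w j,
      ((0 : ℂ) + ∑ a ∈ u i, (if c ∈ N a then (1 : ℂ) else 0))) i j =
      ∏ c ∈ w j, (((u i).filter (fun a => c ∈ N a)).card : ℂ) := by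
    intro i j
    rw [Matrix.of_apply]
    refine Finset.prod_congr rfl fun c _ => ?_
    rw [zero_add, Finset.sum_boole]
  have hmem : ∀ i c, c ∈ w i ↔ ∃ a ∈ u i, c ∈ N a := by
    intro i c; rw [hN i, Finset.mem_biUnion]
  refine det_ne_zero_of_dominance _ w hw ?_ ?_ h (fun i => (Finset.card_le_univ _).trans (by simp))
  · intro i j hne
    rw [hentry] at hne
    intro c hc
    rw [hmem]
    have hc' := (Finset.prod_ne_zero_iff.mp hne) c hc
    rw [Nat.cast_ne_zero, ← Nat.pos_iff_ne_zero, Finset.card_pos] at hc'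
    obtain ⟨a, ha⟩ := hc'
    rw [Finset.mem_filter] at ha
    exact ⟨a, ha.1, ha.2⟩
  · intro i
    rw [hentry]
    refine Finset.prod_ne_zero_iff.mpr fun c hc => ?_
    rw [Nat.cast_ne_zero, ← Nat.pos_iff_ne_zero, Finset.card_pos]
    obtain ⟨a, ha, hca⟩ := (hmem i c).mp hc
    exact ⟨a, Finset.mem_filter.mpr ⟨ha, hca⟩⟩

/-! ## 3. The `x ↔ y` symmetry and the mirror class -/

/-- **`x ↔ y` symmetry of item 19717's matrix.** If the mirrored layout `(w, u)` is hit in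
`SmallCircuits ℂ (h+h) b`, so is `(u, w)` (rename along the swap of the two halves of `Fin (h + h)`;
degree and size do not increase; the layout matrix becomes the transpose). -/
theorem partitionMinor_hit_symm {ι : Type*} [Fintype ι] [DecidableEq ι] (h b : ℕ)
    (u w : ι → Finset (Fin h))
    (hhit : ∃ f ∈ SmallCircuits ℂ (h + h) b,
      (Matrix.of fun i j : ι => MvPolynomial.coeff
        (∑ a ∈ w i, Finsupp.single (Fin.castAdd h a) 1 +
          ∑ c ∈ u j, Finsupp.single (Fin.natAdd h c) 1) f).det ≠ 0) :
    ∃ f ∈ SmallCircuits ℂ (h + h) b,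
      (Matrix.of fun i j : ι => MvPolynomial.coeff
        (∑ a ∈ u i, Finsupp.single (Fin.castAdd h a) 1 +
          ∑ c ∈ w j, Finsupp.single (Fin.natAdd h c) 1) f).det ≠ 0 := by
  obtain ⟨f, ⟨hdeg, hsize⟩, hdet⟩ := hhit
  let τ : Fin (h + h) ≃ Fin (h + h) :=
    finSumFinEquiv.symm.trans ((Equiv.sumComm (Fin h) (Fin h)).trans finSumFinEquiv)
  have hτ1 : ∀ a : Fin h, τ (Fin.castAdd h a) = Fin.natAdd h a := by
    intro a
    simp only [τ, Equiv.trans_apply, finSumFinEquiv_symm_apply_castAdd, Equiv.sumComm_apply,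
      Sum.swap_inl, finSumFinEquiv_apply_right]
  have hτ2 : ∀ c : Fin h, τ (Fin.natAdd h c) = Fin.castAdd h c := by
    intro c
    simp only [τ, Equiv.trans_apply, finSumFinEquiv_symm_apply_natAdd, Equiv.sumComm_apply,
      Sum.swap_inr, finSumFinEquiv_apply_left]
  have hmap : ∀ S T : Finset (Fin h), Finsupp.mapDomain τ
      (∑ a ∈ S, Finsupp.single (Fin.castAdd h a) 1 + ∑ c ∈ T, Finsupp.single (Fin.natAdd h c) 1 :
        Fin (h + h) →₀ ℕ) =
      ∑ a ∈ T, Finsupp.single (Fin.castAdd h a) 1 + ∑ c ∈ S, Finsupp.single (Fin.natAdd h c) 1 := by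
    intro S T
    rw [Finsupp.mapDomain_add, Finsupp.mapDomain_finsetSum, Finsupp.mapDomain_finsetSum]
    simp only [Finsupp.mapDomain_single, hτ1, hτ2]
    exact add_comm _ _
  refine ⟨rename τ f, ⟨(totalDegree_rename_le _ f).trans hdeg,
    (complexity_rename_le_holds' _ f).trans hsize⟩, ?_⟩
  have hmat : (Matrix.of fun i j : ι => MvPolynomial.coeff
      (∑ a ∈ u i, Finsupp.single (Fin.castAdd h a) 1 +
        ∑ c ∈ w j, Finsupp.single (Fin.natAdd h c) 1) (rename τ f)) =
      (Matrix.of fun i j : ι => MvPolynomial.coeff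
        (∑ a ∈ w i, Finsupp.single (Fin.castAdd h a) 1 +
          ∑ c ∈ u j, Finsupp.single (Fin.natAdd h c) 1) f).transpose := by
    ext i j
    rw [Matrix.transpose_apply, Matrix.of_apply, Matrix.of_apply, ← hmap (w j) (u i),
      coeff_rename_mapDomain _ τ.injective]
  rw [hmat, Matrix.det_transpose]
  exact hdet

/-- **The mirror class: OR-projections on the row side.** If `u i = ⋃_{c ∈ w i} N c` (`u` injective,
`h ≥ 2`), the layout matrix of `(u, w)` is nonsingular at some `f ∈ SmallCircuits ℂ (h+h) 5`. -/
theorem partitionMinor_hit_of_orProjection_rows {ι : Type*} [Fintype ι] [DecidableEq ι] (h : ℕ)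
    (hh : 2 ≤ h) (u w : ι → Finset (Fin h)) (hu : Function.Injective u)
    (N : Fin h → Finset (Fin h)) (hN : ∀ i, u i = (w i).biUnion N) :
    ∃ f ∈ SmallCircuits ℂ (h + h) 5,
      (Matrix.of fun i j : ι => MvPolynomial.coeff
        (∑ a ∈ u i, Finsupp.single (Fin.castAdd h a) 1 +
          ∑ c ∈ w j, Finsupp.single (Fin.natAdd h c) 1) f).det ≠ 0 :=
  partitionMinor_hit_symm h 5 u w (partitionMinor_hit_of_orProjection h hh w u hu N hN)

/-- **OR-projection layouts, item 19717's indexing.** For `h ≥ 2`, every injective layout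
`u, w : Fin r → Finset (Fin h)` with `w i = ⋃_{a ∈ u i} N a` for some labelling `N` has a nonsingular
partition minor at some `f ∈ SmallCircuits ℂ (h+h) 5` — uniformly in `r` (no size restriction). -/
theorem partitionMinor_hit_of_orProjection_fin (h : ℕ) (hh : 2 ≤ h) (r : ℕ)
    (u w : Fin r → Finset (Fin h)) (hw : Function.Injective w)
    (N : Fin h → Finset (Fin h)) (hN : ∀ i, w i = (u i).biUnion N) :
    ∃ f ∈ SmallCircuits ℂ (h + h) 5,
      (Matrix.of fun i j : Fin r => MvPolynomial.coeff
        (∑ a ∈ u i, Finsupp.single (Fin.castAdd h a) 1 +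
          ∑ c ∈ w j, Finsupp.single (Fin.natAdd h c) 1) f).det ≠ 0 :=
  partitionMinor_hit_of_orProjection h hh u w hw N hN

/-! ## 4. AFFINE-TEST projections (appended 2026-08-27, val-np-p6 gen 3)

The dominance argument needs only the ZERO PATTERN of the additive table. Give every column coordinate
`c` an affine test `f_c(S) = Σ_{a ∈ S} lam c a − t c` (any complex weights and targets). If the columns are
read off the rows by these tests — `c ∈ w i ↔ f_c(u i) ≠ 0` — then the table `ω a c = lam c a`,
`ω₀ c = −t c` has entry `∏_{c ∈ w j} f_c(u i)`, nonzero iff `w j ⊆ w i`, and the layout is hit. This one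
class contains: OR-projections (§2: `lam c a = [c ∈ N a]`, `t = 0`), ALL hyperoctahedral-automorphic layouts
`w i = π(u i) ∆ Z` (`lam c a = [a = π⁻¹ c]`, `t c = [c ∈ Z]`: a permutation composed with a translation —
the class of `…AutomorphicLayouts`, here at `b = 5` by a different witness), complements, threshold detectors
`c ∈ w i ↔ |u i ∩ A c| ≠ t c`, and injective restrictions of the `𝔽₂`-linear maps `S ↦ S ∆ π⁻¹(S)`
(`lam c a = [a = c] − [a = π c]`, `t = 0`) — a first slice of the «(U, g U), g linear over 𝔽₂» programme. -/

/-- **AFFINE-TEST projection layouts are hit.** If there are weights `lam : Fin h → Fin h → ℂ` and targets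
`t : Fin h → ℂ` with `c ∈ w i ↔ Σ_{a ∈ u i} lam c a ≠ t c` for all `i, c` (`w` injective, `h ≥ 2`), the
layout matrix of `(u, w)` is nonsingular at some `f ∈ SmallCircuits ℂ (h+h) 5`. -/
theorem partitionMinor_hit_of_affineTests {ι : Type*} [Fintype ι] [DecidableEq ι] (h : ℕ)
    (hh : 2 ≤ h) (u w : ι → Finset (Fin h)) (hw : Function.Injective w)
    (lam : Fin h → Fin h → ℂ) (t : Fin h → ℂ)
    (htest : ∀ i c, c ∈ w i ↔ (∑ a ∈ u i, lam c a) ≠ t c) :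
    ∃ f ∈ SmallCircuits ℂ (h + h) 5,
      (Matrix.of fun i j : ι => MvPolynomial.coeff
        (∑ a ∈ u i, Finsupp.single (Fin.castAdd h a) 1 +
          ∑ c ∈ w j, Finsupp.single (Fin.natAdd h c) 1) f).det ≠ 0 := by
  refine partitionMinor_hit_of_additive_mem h hh u w (fun c => -t c) (fun a c => lam c a) ?_
  have hfac : ∀ i c, ((-t c + ∑ a ∈ u i, lam c a) ≠ 0) ↔ c ∈ w i := by
    intro i c
    rw [htest i c, neg_add_eq_sub, sub_ne_zero]
  refine det_ne_zero_of_dominance _ w hw ?_ ?_ h (fun i => (Finset.card_le_univ _).trans (by simp))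
  · intro i j hne c hc
    rw [Matrix.of_apply] at hne
    exact (hfac i c).mp ((Finset.prod_ne_zero_iff.mp hne) c hc)
  · intro i
    rw [Matrix.of_apply]
    exact Finset.prod_ne_zero_iff.mpr fun c hc => (hfac i c).mpr hc

/-- **Hyperoctahedral-automorphic layouts through the additive door**: `w i = (u i).image π ∆ Z` for a
permutation `π` of the coordinates and a translation set `Z` (`w` injective, `h ≥ 2`) ⇒ hit at `b = 5`
(the affine tests `lam c a = [π a = c]`, `t c = [c ∈ Z]`). -/
theorem partitionMinor_hit_of_automorphic_additive {ι : Type*} [Fintype ι] [DecidableEq ι] (h : ℕ)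
    (hh : 2 ≤ h) (u w : ι → Finset (Fin h)) (hw : Function.Injective w)
    (π : Equiv.Perm (Fin h)) (Z : Finset (Fin h))
    (hN : ∀ i, w i = symmDiff ((u i).image π) Z) :
    ∃ f ∈ SmallCircuits ℂ (h + h) 5,
      (Matrix.of fun i j : ι => MvPolynomial.coeff
        (∑ a ∈ u i, Finsupp.single (Fin.castAdd h a) 1 +
          ∑ c ∈ w j, Finsupp.single (Fin.natAdd h c) 1) f).det ≠ 0 := by
  classical
  refine partitionMinor_hit_of_affineTests h hh u w hw
    (fun c a => if π a = c then 1 else 0) (fun c => if c ∈ Z then 1 else 0) ?_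
  intro i c
  have hsum : (∑ a ∈ u i, (if π a = c then (1 : ℂ) else 0)) = if c ∈ (u i).image π then 1 else 0 := by
    rw [Finset.sum_boole]
    by_cases hc : c ∈ (u i).image π
    · rw [if_pos hc]
      obtain ⟨a, ha, rfl⟩ := Finset.mem_image.mp hc
      have : (u i).filter (fun a' => π a' = π a) = {a} := by
        ext a'
        simp only [Finset.mem_filter, Finset.mem_singleton]
        constructor
        · rintro ⟨_, h2⟩; exact π.injective h2
        · rintro rfl; exact ⟨ha, rfl⟩
      rw [this, Finset.card_singleton, Nat.cast_one]
    · rw [if_neg hc]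
      have : (u i).filter (fun a' => π a' = c) = ∅ := by
        refine Finset.filter_eq_empty_iff.mpr fun a ha hac => hc ?_
        exact Finset.mem_image.mpr ⟨a, ha, hac⟩
      rw [this, Finset.card_empty, Nat.cast_zero]
  rw [hN i, Finset.mem_symmDiff, hsum]
  by_cases h1 : c ∈ (u i).image π <;> by_cases h2 : c ∈ Z <;> simp [h1, h2]

/-! ## 5. RANKED affine tests (appended 2026-08-27, val-np-p6 gen 3)

The bijection `σ(u i) = w i` of §4 is not needed: it suffices that every column `c ∈ w i` passes its test on
its own row (`f_c(u i) ≠ 0`, nonzero diagonal) and that the relation «all of `w j` passes on row `i`»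
(`i ≠ j`) is ACYCLIC, witnessed by a ranking `ρ : ι → ℕ` with `ρ j < ρ i`. Then the additive matrix is
block-triangular for `ρ` with diagonal blocks that are diagonal. Example beyond §4: `f_c(S) = [c ∈ S]`
(table `ω a c = [a = c]`, `t = 0`), columns `w i ⊆ u i` ANY sub-sets of the rows whose containment digraph
`w j ⊆ u i` is acyclic. -/

/-- A square complex matrix with nonzero diagonal whose off-diagonal nonzero entries `M i j ≠ 0` force
`ρ j < ρ i` for a ranking `ρ` is nonsingular. -/
theorem det_ne_zero_of_ranking {ι : Type*} [Fintype ι] [DecidableEq ι] (M : Matrix ι ι ℂ)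
    (ρ : ι → ℕ) (hoff : ∀ i j, i ≠ j → M i j ≠ 0 → ρ j < ρ i) (hdiag : ∀ i, M i i ≠ 0) :
    M.det ≠ 0 := by
  have hBT : M.BlockTriangular (fun i => OrderDual.toDual (ρ i)) := by
    intro i j hij
    by_contra hne
    by_cases hij' : i = j
    · subst hij'; exact lt_irrefl _ hij
    · have := hoff i j hij' hne
      exact lt_asymm hij (OrderDual.toDual_lt_toDual.mpr this)
  rw [hBT.det]
  refine Finset.prod_ne_zero_iff.mpr fun t _ => ?_
  have hD : M.toSquareBlock (fun i => OrderDual.toDual (ρ i)) t =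
      Matrix.diagonal (fun i : {i // OrderDual.toDual (ρ i) = t} => M i.1 i.1) := by
    ext i j
    rw [Matrix.toSquareBlock_def, Matrix.of_apply, Matrix.diagonal_apply]
    by_cases hij : i = j
    · subst hij; rw [if_pos rfl]
    · rw [if_neg hij]
      by_contra hne
      have h1 := hoff i.1 j.1 (fun heq => hij (Subtype.ext heq)) hne
      have h2 : ρ i.1 = ρ j.1 :=
        OrderDual.toDual.injective (i.2.trans j.2.symm)
      omega
  rw [hD, Matrix.det_diagonal]
  exact Finset.prod_ne_zero_iff.mpr fun i _ => hdiag i.1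

/-- **RANKED affine-test layouts are hit.** Weights `lam`, targets `t`, a ranking `ρ : ι → ℕ`; if every
`c ∈ w i` has `Σ_{a∈u i} lam c a ≠ t c`, and whenever ALL `c ∈ w j` pass on row `i ≠ j` we have
`ρ j < ρ i`, then the layout matrix of `(u, w)` is nonsingular at some `f ∈ SmallCircuits ℂ (h+h) 5`
(`h ≥ 2`). -/
theorem partitionMinor_hit_of_rankedTests {ι : Type*} [Fintype ι] [DecidableEq ι] (h : ℕ)
    (hh : 2 ≤ h) (u w : ι → Finset (Fin h)) (lam : Fin h → Fin h → ℂ) (t : Fin h → ℂ) (ρ : ι → ℕ)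
    (hdiag : ∀ i, ∀ c ∈ w i, (∑ a ∈ u i, lam c a) ≠ t c)
    (hoff : ∀ i j, i ≠ j → (∀ c ∈ w j, (∑ a ∈ u i, lam c a) ≠ t c) → ρ j < ρ i) :
    ∃ f ∈ SmallCircuits ℂ (h + h) 5,
      (Matrix.of fun i j : ι => MvPolynomial.coeff
        (∑ a ∈ u i, Finsupp.single (Fin.castAdd h a) 1 +
          ∑ c ∈ w j, Finsupp.single (Fin.natAdd h c) 1) f).det ≠ 0 := by
  refine partitionMinor_hit_of_additive_mem h hh u w (fun c => -t c) (fun a c => lam c a) ?_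
  have hfac : ∀ i c, ((-t c + ∑ a ∈ u i, lam c a) ≠ 0) ↔ (∑ a ∈ u i, lam c a) ≠ t c := by
    intro i c
    rw [neg_add_eq_sub, sub_ne_zero]
  refine det_ne_zero_of_ranking _ ρ ?_ ?_
  · intro i j hij hne
    rw [Matrix.of_apply] at hne
    exact hoff i j hij fun c hc => (hfac i c).mp ((Finset.prod_ne_zero_iff.mp hne) c hc)
  · intro i
    rw [Matrix.of_apply]
    exact Finset.prod_ne_zero_iff.mpr fun c hc => (hfac i c).mpr (hdiag i c hc)

/-- **Acyclic sub-set layouts are hit**: `w i ⊆ u i` for all `i`, and the cross-containments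
`w j ⊆ u i` (`i ≠ j`) are acyclic (ranking `ρ`). Table `ω a c = [a = c]`, `t = 0`. -/
theorem partitionMinor_hit_of_acyclicSubsets {ι : Type*} [Fintype ι] [DecidableEq ι] (h : ℕ)
    (hh : 2 ≤ h) (u w : ι → Finset (Fin h)) (ρ : ι → ℕ) (hsub : ∀ i, w i ⊆ u i)
    (hacyc : ∀ i j, i ≠ j → w j ⊆ u i → ρ j < ρ i) :
    ∃ f ∈ SmallCircuits ℂ (h + h) 5,
      (Matrix.of fun i j : ι => MvPolynomial.coeff
        (∑ a ∈ u i, Finsupp.single (Fin.castAdd h a) 1 +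
          ∑ c ∈ w j, Finsupp.single (Fin.natAdd h c) 1) f).det ≠ 0 := by
  classical
  have hsum : ∀ i c, (∑ a ∈ u i, (if a = c then (1 : ℂ) else 0)) = if c ∈ u i then 1 else 0 := by
    intro i c
    rw [Finset.sum_ite_eq' (u i) c]
  refine partitionMinor_hit_of_rankedTests h hh u w (fun c a => if a = c then 1 else 0) (fun _ => 0) ρ
    ?_ ?_
  · intro i c hc
    rw [hsum, if_pos (hsub i hc)]
    exact one_ne_zero
  · intro i j hij hall
    refine hacyc i j hij fun c hc => ?_
    have := hall c hc
    rw [hsum] at this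
    by_contra hcu
    rw [if_neg hcu] at this
    exact this rfl

end

end Summit.ValiantsHypothesis.ValiantsHypothesis.Theorems.BarrierLever.AdditiveDoor
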